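import Literature.Probability.RandomPlanarGeometry.SAWUnfolding
import Literature.Probability.RandomPlanarGeometry.SAWBridgeUpperBound
import HarnessLib

/-!
# The Hammersley–Welsh bridge bound `e^{-c√n} μⁿ ≤ bₙ` (Madras–Slade, Theorem 3.1.1 /
# Corollary 3.1.6): discharge of `DKY2014_eq21` and of `BDGS2012_HammersleyWelsh`

Topic `Literature/Probability/RandomPlanarGeometry`. Source: N. Madras, G. Slade, *The
Self-Avoiding Walk* (1993), §3.1, proof of Theorem 3.1.1: "split each self-avoiding walk into two
half-space walks, and then use Proposition 3.1.5" — `c_n ≤ Σ_{m=0}^{n} h_{n-m} h_{m+1}` (first line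
of (3.1.7), the tree's `Zd.count_le_sum_halfSpaceCount`), `h_N ≤ P_D(N) b_N` (Proposition 3.1.5,
the tree's explicit `Zd.halfSpaceCount_le_exp_mul_bridgeCount : hₙ ≤ e^{3√n} bₙ`), and
`b_i b_j ≤ b_{i+j}` ((1.2.15), `Zd.bridgeCount_mul_le`), whence `c_n ≤ b_{n+1} K² e^{B√(n+1)}`
(3.1.7) and, with `μⁿ ≤ cₙ` ((1.2.10)) applied at `N − 1`, Corollary 3.1.6, eq. (3.1.9) (p. 61): "for all sufficiently
large `N`, `μ^{N−1} e^{−BN^{1/2}} ≤ b_N ≤ μ^N`" (as printed: the lower exponent is `N − 1`; the tree's form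
`e^{-c√n} μⁿ ≤ bₙ` for EVERY `n` absorbs the factor `μ^{-1}` and the threshold into `c`).

## Contents (all PROVED)

* `Zd.count_le_mul_exp_mul_bridgeCount` — `cₙ ≤ (n+1) e^{6√(n+1)} b_{n+1}` on `ℤ^d`, `d ≥ 1`;
* `Zd.exp_mul_pow_le_bridgeCount` — **`e^{-c√n} μⁿ ≤ bₙ`** for all `n`, with
  `c = count d 1 + 8` (Corollary 3.1.6, explicit elementary constant);
* `BDGS2012_HammersleyWelsh_holds` — discharge of the named fact `BDGS2012_HammersleyWelsh`
  (`cₙ ≤ μⁿ e^{κ√n}`, BDGS 2012 (1.25); here for every `d ≥ 2` as stated, indeed any `d ≥ 1`);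
* **`DKY2014_eq21_holds : DKY2014_eq21`** — discharge of eq. (2.1) of Duminil-Copin–Kozma–Yadin
  2014, `e^{-c√n} μⁿ ≤ bₙ ≤ μⁿ` for the Walk-bridges of `ℤ²` (`DKY2014_eq21_of_lowerBound`,
  `bridgeCount_eq_zd` of `SAWBridgeUpperBound.lean`).
-/

noncomputable section

open Finset Literature.Probability.LatticeModels Literature.Probability.Percolation
open scoped BigOperators

namespace Literature.Probability.RandomPlanarGeometry.SAW

namespace Zd

variable {d : ℕ} [NeZero d]

/-- **`cₙ ≤ (n+1) e^{6√(n+1)} b_{n+1}`** (Madras–Slade (3.1.7) with explicit constants): split at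
the last minimum into two half-space walks, unfold each into a bridge (`≤ e^{3√·}`-to-one), and
concatenate the two bridges. [cite: MadrasSlade1993, §3.1, proof of Theorem 3.1.1, eq. (3.1.7)] -/
theorem count_le_mul_exp_mul_bridgeCount (n : ℕ) :
    (count d n : ℝ) ≤ (n + 1) * Real.exp (6 * Real.sqrt (n + 1)) * bridgeCount d (n + 1) := by
  have h1 : (count d n : ℝ) ≤
      ∑ m ∈ Finset.range (n + 1), (halfSpaceCount d (m + 1) : ℝ) * halfSpaceCount d (n - m) := by
    exact_mod_cast count_le_sum_halfSpaceCount (d := d) n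
  refine h1.trans ?_
  have hterm : ∀ m ∈ Finset.range (n + 1),
      (halfSpaceCount d (m + 1) : ℝ) * halfSpaceCount d (n - m) ≤
        Real.exp (6 * Real.sqrt (n + 1)) * bridgeCount d (n + 1) := by
    intro m hm
    rw [Finset.mem_range] at hm
    have ha := halfSpaceCount_le_exp_mul_bridgeCount (d := d) (m + 1)
    have hb := halfSpaceCount_le_exp_mul_bridgeCount (d := d) (n - m)
    have hmn : (m : ℝ) ≤ n := by exact_mod_cast Nat.le_of_lt_succ hm
    have hsa : Real.sqrt ((m + 1 : ℕ) : ℝ) ≤ Real.sqrt (n + 1) :=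
      Real.sqrt_le_sqrt (by push_cast; linarith)
    have hsb : Real.sqrt ((n - m : ℕ) : ℝ) ≤ Real.sqrt (n + 1) :=
      Real.sqrt_le_sqrt (by
        have : ((n - m : ℕ) : ℝ) ≤ n := by exact_mod_cast Nat.sub_le n m
        linarith)
    have hbb : (bridgeCount d (m + 1) : ℝ) * bridgeCount d (n - m) ≤ bridgeCount d (n + 1) := by
      have := bridgeCount_mul_le (d := d) (m + 1) (n - m)
      rw [show m + 1 + (n - m) = n + 1 by omega] at this
      exact_mod_cast this
    have h0a : (0 : ℝ) ≤ halfSpaceCount d (m + 1) := Nat.cast_nonneg _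
    have h0b : (0 : ℝ) ≤ bridgeCount d (n - m) := Nat.cast_nonneg _
    calc (halfSpaceCount d (m + 1) : ℝ) * halfSpaceCount d (n - m)
        ≤ (Real.exp (3 * Real.sqrt ((m + 1 : ℕ) : ℝ)) * bridgeCount d (m + 1)) *
            (Real.exp (3 * Real.sqrt ((n - m : ℕ) : ℝ)) * bridgeCount d (n - m)) :=
          mul_le_mul ha hb (Nat.cast_nonneg _) (by positivity)
      _ ≤ (Real.exp (3 * Real.sqrt (n + 1)) * bridgeCount d (m + 1)) *
            (Real.exp (3 * Real.sqrt (n + 1)) * bridgeCount d (n - m)) := by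
          gcongr
      _ = Real.exp (6 * Real.sqrt (n + 1)) * ((bridgeCount d (m + 1) : ℝ) * bridgeCount d (n - m)) := by
          rw [show (6 : ℝ) * Real.sqrt (n + 1) = 3 * Real.sqrt (n + 1) + 3 * Real.sqrt (n + 1) by ring,
            Real.exp_add]; ring
      _ ≤ Real.exp (6 * Real.sqrt (n + 1)) * bridgeCount d (n + 1) :=
          mul_le_mul_of_nonneg_left hbb (Real.exp_nonneg _)
  calc ∑ m ∈ Finset.range (n + 1), (halfSpaceCount d (m + 1) : ℝ) * halfSpaceCount d (n - m)
      ≤ ∑ _m ∈ Finset.range (n + 1), Real.exp (6 * Real.sqrt (n + 1)) * bridgeCount d (n + 1) :=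
        Finset.sum_le_sum hterm
    _ = (n + 1) * Real.exp (6 * Real.sqrt (n + 1)) * bridgeCount d (n + 1) := by
        rw [Finset.sum_const, Finset.card_range, nsmul_eq_mul]; push_cast; ring

/-- **Hammersley–Welsh lower bound `e^{-c√n} μⁿ ≤ bₙ`** (Madras–Slade Corollary 3.1.6, (3.1.9):
"`μ^{N−1} e^{−BN^{1/2}} ≤ b_N`" for all sufficiently large `N`), here for every `n`, with the explicit constant `c = c₁ + 8`, `c₁ = count d 1`:
from `μ^{n-1} ≤ c_{n-1} ≤ n e^{6√n} bₙ` and `μ n ≤ e^{(c₁+2)√n}`.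
[cite: MadrasSlade1993, Corollary 3.1.6, eq. (3.1.9) (p. 61)] -/
theorem exp_mul_pow_le_bridgeCount :
    ∃ c : ℝ, ∀ n : ℕ, Real.exp (-(c * Real.sqrt n)) * connectiveConstant d ^ n ≤ bridgeCount d n := by
  refine ⟨(count d 1 : ℝ) + 8, fun n => ?_⟩
  rcases Nat.eq_zero_or_pos n with rfl | hn
  · have : 1 ≤ bridgeCount d 0 := one_le_bridgeCount 0
    simp only [Nat.cast_zero, Real.sqrt_zero, mul_zero, neg_zero, Real.exp_zero, pow_zero, one_mul]
    exact_mod_cast this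
  obtain ⟨k, rfl⟩ := Nat.exists_eq_succ_of_ne_zero hn.ne'
  -- `μ^k ≤ c_k ≤ (k+1) e^{6√(k+1)} b_{k+1}`
  have hμ := connectiveConstant_pos d
  have h1 : connectiveConstant d ^ k ≤ ((k : ℝ) + 1) * Real.exp (6 * Real.sqrt (k + 1)) * bridgeCount d (k + 1) :=
    (pow_connectiveConstant_le_count d k).trans (count_le_mul_exp_mul_bridgeCount k)
  -- `μ ≤ c₁` and `k+1 ≤ e^{2√(k+1)}`
  set s : ℝ := Real.sqrt ((k.succ : ℕ) : ℝ) with hs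
  have hs1 : 1 ≤ s := by
    rw [hs, Real.le_sqrt (by norm_num) (Nat.cast_nonneg _)]; push_cast; linarith
  have hs0 : 0 ≤ s := zero_le_one.trans hs1
  have hμle : connectiveConstant d ≤ count d 1 := by
    have := connectiveConstant_le_rpow (d := d) one_ne_zero
    simpa using this
  have hμexp : connectiveConstant d ≤ Real.exp ((count d 1 : ℝ) * s) := by
    refine hμle.trans ?_
    calc (count d 1 : ℝ) ≤ (count d 1 : ℝ) * s := le_mul_of_one_le_right (Nat.cast_nonneg _) hs1
      _ ≤ (count d 1 : ℝ) * s + 1 := by linarith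
      _ ≤ Real.exp ((count d 1 : ℝ) * s) := Real.add_one_le_exp _
  have hkexp : ((k : ℝ) + 1) ≤ Real.exp (2 * s) := by
    -- `k + 1 = s² ≤ (e^s)² = e^{2s}` as `s ≤ e^s`
    have h2 : ((k : ℝ) + 1) = s ^ 2 := by
      rw [hs, Real.sq_sqrt (Nat.cast_nonneg _)]; push_cast; ring
    have h3 : s ≤ Real.exp s := by linarith [Real.add_one_le_exp s]
    rw [h2, show (2 : ℝ) * s = s + s by ring, Real.exp_add, sq]
    exact mul_le_mul h3 h3 hs0 (Real.exp_nonneg _)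
  have hsk : Real.sqrt ((k : ℝ) + 1) = s := by rw [hs]; push_cast; ring_nf
  -- assemble: `e^{-(c₁+8)s} μ^{k+1} ≤ b_{k+1}`
  have hb0 : (0 : ℝ) ≤ bridgeCount d (k + 1) := Nat.cast_nonneg _
  have key : Real.exp (-(((count d 1 : ℝ) + 8) * s)) * connectiveConstant d ^ (k + 1) ≤
      bridgeCount d (k + 1) := by
    rw [pow_succ]
    -- `μ^k · μ ≤ (k+1) e^{6s} b · e^{c₁ s} ≤ e^{2s} e^{6s} e^{c₁ s} b = e^{(c₁+8)s} b`
    have e1 : connectiveConstant d ^ k * connectiveConstant d ≤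
        (((k : ℝ) + 1) * Real.exp (6 * s) * bridgeCount d (k + 1)) * Real.exp ((count d 1 : ℝ) * s) := by
      rw [hsk] at h1
      exact mul_le_mul h1 hμexp hμ.le (by positivity)
    have e2 : (((k : ℝ) + 1) * Real.exp (6 * s) * bridgeCount d (k + 1)) * Real.exp ((count d 1 : ℝ) * s) ≤
        Real.exp (((count d 1 : ℝ) + 8) * s) * bridgeCount d (k + 1) := by
      have : ((k : ℝ) + 1) * Real.exp (6 * s) * Real.exp ((count d 1 : ℝ) * s) ≤
          Real.exp (((count d 1 : ℝ) + 8) * s) := by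
        calc ((k : ℝ) + 1) * Real.exp (6 * s) * Real.exp ((count d 1 : ℝ) * s)
            ≤ Real.exp (2 * s) * Real.exp (6 * s) * Real.exp ((count d 1 : ℝ) * s) := by
              gcongr
          _ = Real.exp (((count d 1 : ℝ) + 8) * s) := by
              rw [← Real.exp_add, ← Real.exp_add]; ring_nf
      calc (((k : ℝ) + 1) * Real.exp (6 * s) * bridgeCount d (k + 1)) * Real.exp ((count d 1 : ℝ) * s)
          = (((k : ℝ) + 1) * Real.exp (6 * s) * Real.exp ((count d 1 : ℝ) * s)) * bridgeCount d (k + 1) := by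
            ring
        _ ≤ Real.exp (((count d 1 : ℝ) + 8) * s) * bridgeCount d (k + 1) :=
            mul_le_mul_of_nonneg_right this hb0
    have e3 := e1.trans e2
    rw [Real.exp_neg, inv_mul_le_iff₀ (Real.exp_pos _)]
    exact e3
  simpa [hs] using key

/-! ### Discharges: `BDGS2012_HammersleyWelsh` and `DKY2014_eq21` -/

/-- **Discharge of `BDGS2012_HammersleyWelsh`** ("`μⁿ ≤ cₙ ≤ μⁿ e^{κ√n}`, the upper bound is
nontrivial", BDGS 2012 (1.25), Hammersley–Welsh 1962): `cₙ ≤ (n+1) e^{6√(n+1)} b_{n+1} ≤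
(n+1) e^{6√(n+1)} μ^{n+1} ≤ μⁿ e^{κ√n}` with `κ = c₁ + 15`. [cite: BDGS2012, §1.5.1, eq. (1.25)] -/
theorem BDGS2012_HammersleyWelsh_holds : BDGS2012_HammersleyWelsh := by
  intro d hd
  haveI : NeZero d := ⟨by omega⟩
  refine ⟨(count d 1 : ℝ) + 15, fun n => ?_⟩
  rcases Nat.eq_zero_or_pos n with rfl | hn
  · simp [count_zero]
  have hμ := connectiveConstant_pos d
  have h1 := count_le_mul_exp_mul_bridgeCount (d := d) n
  have h2 : (bridgeCount d (n + 1) : ℝ) ≤ connectiveConstant d ^ (n + 1) := bridgeCount_le_pow (n + 1)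
  set s : ℝ := Real.sqrt n with hs
  have hn1 : (1 : ℝ) ≤ n := by exact_mod_cast hn
  have hs1 : 1 ≤ s := by rw [hs, Real.le_sqrt (by norm_num) (by linarith)]; linarith
  have hs0 : 0 ≤ s := zero_le_one.trans hs1
  -- `√(n+1) ≤ 2s`, `n+1 ≤ e^{3s}`, `μ ≤ e^{c₁ s}`
  have hsq : Real.sqrt (n + 1) ≤ 2 * s := by
    rw [Real.sqrt_le_left (by positivity), hs, mul_pow, Real.sq_sqrt (by linarith)]
    linarith
  have hn_exp : (n : ℝ) + 1 ≤ Real.exp (3 * s) := by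
    have h2' : (n : ℝ) = s ^ 2 := by rw [hs, Real.sq_sqrt (by linarith)]
    have h3 : s ≤ Real.exp s := by linarith [Real.add_one_le_exp s]
    have h4 : s ^ 2 ≤ Real.exp (2 * s) := by
      rw [show (2 : ℝ) * s = s + s by ring, Real.exp_add, sq]
      exact mul_le_mul h3 h3 hs0 (Real.exp_nonneg _)
    have h5 : (1 : ℝ) ≤ Real.exp s := Real.one_le_exp hs0
    have h6 : (1 : ℝ) ≤ Real.exp (2 * s) := Real.one_le_exp (by positivity)
    have h7 : s + 1 ≤ Real.exp s := Real.add_one_le_exp s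
    calc (n : ℝ) + 1 = s ^ 2 + 1 := by rw [h2']
      _ ≤ Real.exp (2 * s) + 1 := by linarith
      _ ≤ Real.exp (2 * s) + Real.exp (2 * s) * s := by nlinarith
      _ = Real.exp (2 * s) * (s + 1) := by ring
      _ ≤ Real.exp (2 * s) * Real.exp s := mul_le_mul_of_nonneg_left h7 (Real.exp_nonneg _)
      _ = Real.exp (3 * s) := by rw [← Real.exp_add]; ring_nf
  have hμle : connectiveConstant d ≤ count d 1 := by
    have := connectiveConstant_le_rpow (d := d) one_ne_zero
    simpa using this
  have hμexp : connectiveConstant d ≤ Real.exp ((count d 1 : ℝ) * s) := by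
    refine hμle.trans ?_
    calc (count d 1 : ℝ) ≤ (count d 1 : ℝ) * s := le_mul_of_one_le_right (Nat.cast_nonneg _) hs1
      _ ≤ (count d 1 : ℝ) * s + 1 := by linarith
      _ ≤ Real.exp ((count d 1 : ℝ) * s) := Real.add_one_le_exp _
  calc (count d n : ℝ) ≤ (n + 1) * Real.exp (6 * Real.sqrt (n + 1)) * bridgeCount d (n + 1) := h1
    _ ≤ (n + 1) * Real.exp (6 * Real.sqrt (n + 1)) * connectiveConstant d ^ (n + 1) := by gcongr
    _ = connectiveConstant d ^ n *
          ((n + 1) * Real.exp (6 * Real.sqrt (n + 1)) * connectiveConstant d) := by ring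
    _ ≤ connectiveConstant d ^ n *
          (Real.exp (3 * s) * Real.exp (6 * (2 * s)) * Real.exp ((count d 1 : ℝ) * s)) := by
        gcongr
    _ = connectiveConstant d ^ n * Real.exp (((count d 1 : ℝ) + 15) * s) := by
        rw [← Real.exp_add, ← Real.exp_add]; ring_nf

end Zd

/-- **Discharge of `DKY2014_eq21`**, eq. (2.1) of Duminil-Copin–Kozma–Yadin 2014: "The number
`bₙ` of self-avoiding bridges of length `n` … satisfies `e^{-c√n} μⁿ ≤ bₙ ≤ μⁿ` for every `n`"
(Hammersley–Welsh 1962; Madras–Slade Corollary 3.1.6 and (1.2.17)), for the Walk-bridges of `ℤ²`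
of `SupercriticalSAWPolygons.lean`. [cite: DuminilCopinKozmaYadin2014, §2, eq. (2.1)] -/
theorem DKY2014_eq21_holds : DKY2014_eq21 := by
  obtain ⟨c, hc⟩ := Zd.exp_mul_pow_le_bridgeCount (d := 2)
  refine DKY2014_eq21_of_lowerBound ⟨c, fun n => ?_⟩
  rw [bridgeCount_eq_zd, ← Zd.connectiveConstant_two]
  exact hc n

end Literature.Probability.RandomPlanarGeometry.SAW
namespace Literature.Probability.RandomPlanarGeometry.SAW

namespace Zd

variable {d : ℕ} [NeZero d]

/-! ### The constant of Corollary 3.1.6 read off: `c = c₁ + 8` -/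

/-- **Hammersley–Welsh lower bound with the constant EXPOSED**: for every `n`,
`e^{-(c₁ + 8)√n} μⁿ ≤ bₙ` with `c₁ = count d 1` (`= 2d`) — the witness of `exp_mul_pow_le_bridgeCount`
(Madras–Slade Corollary 3.1.6, (3.1.9) "`μ^{N−1} e^{−BN^{1/2}} ≤ b_N`") made available by name: `μ^{n-1} ≤ c_{n-1} ≤ n e^{6√n} bₙ`,
`μ ≤ c₁ ≤ e^{c₁√n}`, `n ≤ e^{2√n}`. [cite: MadrasSlade1993, Corollary 3.1.6] -/
theorem exp_mul_pow_le_bridgeCount_explicit (n : ℕ) :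
    Real.exp (-(((count d 1 : ℝ) + 8) * Real.sqrt n)) * connectiveConstant d ^ n ≤ bridgeCount d n := by
  rcases Nat.eq_zero_or_pos n with rfl | hn
  · have : 1 ≤ bridgeCount d 0 := one_le_bridgeCount 0
    simp only [Nat.cast_zero, Real.sqrt_zero, mul_zero, neg_zero, Real.exp_zero, pow_zero, one_mul]
    exact_mod_cast this
  obtain ⟨k, rfl⟩ := Nat.exists_eq_succ_of_ne_zero hn.ne'
  have hμ := connectiveConstant_pos d
  have h1 : connectiveConstant d ^ k ≤ ((k : ℝ) + 1) * Real.exp (6 * Real.sqrt (k + 1)) * bridgeCount d (k + 1) :=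
    (pow_connectiveConstant_le_count d k).trans (count_le_mul_exp_mul_bridgeCount k)
  set s : ℝ := Real.sqrt ((k.succ : ℕ) : ℝ) with hs
  have hs1 : 1 ≤ s := by
    rw [hs, Real.le_sqrt (by norm_num) (Nat.cast_nonneg _)]; push_cast; linarith
  have hs0 : 0 ≤ s := zero_le_one.trans hs1
  have hμle : connectiveConstant d ≤ count d 1 := by
    have := connectiveConstant_le_rpow (d := d) one_ne_zero
    simpa using this
  have hμexp : connectiveConstant d ≤ Real.exp ((count d 1 : ℝ) * s) := by
    refine hμle.trans ?_
    calc (count d 1 : ℝ) ≤ (count d 1 : ℝ) * s := le_mul_of_one_le_right (Nat.cast_nonneg _) hs1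
      _ ≤ (count d 1 : ℝ) * s + 1 := by linarith
      _ ≤ Real.exp ((count d 1 : ℝ) * s) := Real.add_one_le_exp _
  have hkexp : ((k : ℝ) + 1) ≤ Real.exp (2 * s) := by
    have h2 : ((k : ℝ) + 1) = s ^ 2 := by
      rw [hs, Real.sq_sqrt (Nat.cast_nonneg _)]; push_cast; ring
    have h3 : s ≤ Real.exp s := by linarith [Real.add_one_le_exp s]
    rw [h2, show (2 : ℝ) * s = s + s by ring, Real.exp_add, sq]
    exact mul_le_mul h3 h3 hs0 (Real.exp_nonneg _)
  have hsk : Real.sqrt ((k : ℝ) + 1) = s := by rw [hs]; push_cast; ring_nf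
  have hb0 : (0 : ℝ) ≤ bridgeCount d (k + 1) := Nat.cast_nonneg _
  have key : Real.exp (-(((count d 1 : ℝ) + 8) * s)) * connectiveConstant d ^ (k + 1) ≤
      bridgeCount d (k + 1) := by
    rw [pow_succ]
    have e1 : connectiveConstant d ^ k * connectiveConstant d ≤
        (((k : ℝ) + 1) * Real.exp (6 * s) * bridgeCount d (k + 1)) * Real.exp ((count d 1 : ℝ) * s) := by
      rw [hsk] at h1
      exact mul_le_mul h1 hμexp hμ.le (by positivity)
    have e2 : (((k : ℝ) + 1) * Real.exp (6 * s) * bridgeCount d (k + 1)) * Real.exp ((count d 1 : ℝ) * s) ≤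
        Real.exp (((count d 1 : ℝ) + 8) * s) * bridgeCount d (k + 1) := by
      have : ((k : ℝ) + 1) * Real.exp (6 * s) * Real.exp ((count d 1 : ℝ) * s) ≤
          Real.exp (((count d 1 : ℝ) + 8) * s) := by
        calc ((k : ℝ) + 1) * Real.exp (6 * s) * Real.exp ((count d 1 : ℝ) * s)
            ≤ Real.exp (2 * s) * Real.exp (6 * s) * Real.exp ((count d 1 : ℝ) * s) := by
              gcongr
          _ = Real.exp (((count d 1 : ℝ) + 8) * s) := by
              rw [← Real.exp_add, ← Real.exp_add]; ring_nf
      calc (((k : ℝ) + 1) * Real.exp (6 * s) * bridgeCount d (k + 1)) * Real.exp ((count d 1 : ℝ) * s)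
          = (((k : ℝ) + 1) * Real.exp (6 * s) * Real.exp ((count d 1 : ℝ) * s)) * bridgeCount d (k + 1) := by
            ring
        _ ≤ Real.exp (((count d 1 : ℝ) + 8) * s) * bridgeCount d (k + 1) :=
            mul_le_mul_of_nonneg_right this hb0
    have e3 := e1.trans e2
    rw [Real.exp_neg, inv_mul_le_iff₀ (Real.exp_pos _)]
    exact e3
  simpa [hs] using key

/-- Monotonicity in the constant: any `c ≥ c₁ + 8` works in `e^{-c√n} μⁿ ≤ bₙ`.
[cite: MadrasSlade1993, Corollary 3.1.6] -/
theorem exp_mul_pow_le_bridgeCount_of_le {c : ℝ} (hc : ((count d 1 : ℝ) + 8) ≤ c) (n : ℕ) :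
    Real.exp (-(c * Real.sqrt n)) * connectiveConstant d ^ n ≤ bridgeCount d n := by
  refine le_trans ?_ (exp_mul_pow_le_bridgeCount_explicit (d := d) n)
  have hμ := connectiveConstant_pos d
  refine mul_le_mul_of_nonneg_right ?_ (pow_nonneg hμ.le n)
  exact Real.exp_le_exp.2 (by nlinarith [Real.sqrt_nonneg (n : ℝ)])

end Zd

end Literature.Probability.RandomPlanarGeometry.SAW
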